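import Literature.NumberTheory.EllipticCurves.KuriharaNumberKimCertificate
import Literature.NumberTheory.EllipticCurves.KatoKolyvaginPrimes
import HarnessLib

/-!
# Kim's theorem 1.11, (3) ⇒ (1): a non-zero mod-`p` Kurihara number in Kim's class (C.-H. Kim 2022)

Topic `NumberTheory/EllipticCurves`; namespace `Literature.NumberTheory.EllipticCurves`. One named
fact (`def … : Prop`, D-0014): the CLAUSE-FREE companion of `Kim2022_kuriharaNumber_certificate`
(`KuriharaNumberKimCertificate`: the same theorem read WITH its "if we further assume `Ш(E/ℚ)[p]`
is trivial" clause, as a rank formula) and the mod-`p` companion of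
`Kim2022_exists_kuriharaNumber_ne_zero_of_selmerCorank` (`KuriharaNumberKimNonvanishing`: Thm. 1.9
(1) with Cor. 1.6, modulus `p^k`, no torsion/Tamagawa hypotheses). Consumed by the crux
`PlecticLegs.TwistSupply` of `BirchSwinnertonDyer` (stmt-BirchSwinnertonDyer-18260, line `Sketch` =
`kurihara-fourier-support`, stub `stub_kuriharaSupply`): a non-zero MOD-`p` Kurihara number at a
square-free Kolyvagin level `n` is, by finite Fourier analysis on the exponent-`p` quotient of
`(ℤ/n)ˣ`, a Dirichlet character of ORDER `p` with non-vanishing twisted plus-symbol sum — the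
`p^k`-version only yields `p`-power order, which is why the mod-`p` statement with its two extra
hypotheses (iii), (iv) is needed there.

## The printed statements (C.-H. Kim, *The structure of Selmer groups and the Iwasawa main
conjecture for elliptic curves*, arXiv:2203.12159 = Amer. J. Math.; held text, PDF pp. 4–8)

* §1.2.2 (p. 5): `𝒫_k = {ℓ prime : (ℓ, Np) = 1, ℓ ≡ 1 (mod p^k), a_ℓ(E) ≡ ℓ + 1 (mod p^k)}`,
  `𝒩_k` the square-free products of primes in `𝒫_k` (`1 ∈ 𝒩_k`) — tree `Kato.IsKolyvaginProduct`.
* §1.4.1–1.4.3 (p. 7): for `p ≥ 5`, `ρ̄` irreducible and the Manin constant prime to `p`, the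
  symbols `[r]⁺ = Re{∞,r}_f/Ω⁺_E` (Néron period of a global minimal model) are `p`-integral; the
  mod-`I_n` Kurihara number is `δ̃_n = ∑_{a ∈ (ℤ/n)ˣ} \overline{[a/n]⁺} ∏_{ℓ∣n} \overline{log_{η_ℓ}(a)}`,
  "well-defined up to `(ℤ_p/I_nℤ_p)ˣ`"; `δ̃⁽¹⁾_n = δ̃_n mod p ∈ 𝔽_p` for `n ∈ 𝒩₁`.
* THEOREM 1.11 (p. 8). "Let `E` be an elliptic curve over `ℚ` and `p ≥ 5` a prime such that
  (i) `ρ̄` is surjective, (ii) the Manin constant is prime to `p`, (iii) `E(ℚ_p)[p] = 0`, and (iv)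
  all the Tamagawa factors are prime to `p`. Then the following statements are equivalent.
  (1) `δ̃⁽¹⁾_n ≠ 0` in `𝔽_p` for some `n ∈ 𝒩₁` with `ν(n) = ord(δ̃⁽¹⁾)`. (2) The mod `p` Kato's
  Kolyvagin system `κ^{Kato,(1)}` is non-trivial. (3) [Kim's (IMC), Conj. 1.3: Kato's main
  conjecture as an identity of ideals of `Λ`] holds. … If we further assume that `Ш(E/ℚ)[p]` is
  trivial, then we have a mod `p` exact rank formula `rk_ℤ E(ℚ) = ord(δ̃⁽¹⁾) = ν(n)`."
  THIS FILE records (3) ⇒ (1) WITHOUT the further assumption (no `Ш`, no rank): under (i)–(iv)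
  and (3), SOME `n ∈ 𝒩₁` has `δ̃⁽¹⁾_n ≠ 0`.
* Status of (3) at a good ORDINARY `p ≥ 5` with `ρ̄` onto: a THEOREM in print — Kato 2004,
  Thm. 17.4 (3) (`char X ∣ (L_p)` in `Λ`, under `ρ_{E,p^∞}` onto, from `ρ̄` onto and `p ≥ 5` by
  Serre) with Burungale–Castella–Skinner 2025, Thm. 1.1.2 (b) (`(L_p) ∣ char X` in `Λ`, (im) holding
  as `ρ(G_{ℚ(μ_{p^∞})}) ⊇ SL₂(ℤ_p)`), and Kato §17.13 for the passage between Mazur's and Kato's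
  formulations — the audit "Status of statement (3)" in `KuriharaNumberKimCertificate`, reused
  verbatim (including why the paper's own "[Kato, Skinner–Urban, Wan]" needs that replacement:
  Burungale–Castella–Skinner Remark 1.1.3 (ii)).
* Hypothesis (ii) at a GOOD `p ≥ 5` with `ρ̄` onto: automatic, by the paper's remark after
  Cor. 1.6 (p. 6: "The Manin constant is not divisible by a prime `p ≥ 3` if `E` has semi-stable
  reduction at `p` [Mazur 1978]. Thus, the Manin constant assumption is needed only when `E` has
  additive reduction at `p`") for the optimal curve (Mazur 1978 Cor. 4.1 / Abbes–Ullmo 1996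
  Thm. A), transported inside the isogeny class under `E[p]` irreducible (Greenberg–Vatsal 2000,
  Remark 3.4) — exactly as in `KuriharaNumberKimNonvanishing`, and exactly the chain of the
  period-transfer fact `realPeriodRat_eq_unit_mul_plusPeriod` (`ModularCurvePeriodRatio`), which
  this statement carries as an explicit hypothesis anyway.

## The Lean statement and its normalisation

HYPOTHESES, in the tree's vocabulary and in the style of `KuriharaNumberKimNonvanishing`:
`W` globally minimal and elliptic; `5 ≤ p`; good ordinary = `HasGoodReductionAtPrime p ∧ p ∤ a_p`
(`frobeniusTrace`); (i) `HasSurjectiveModNGaloisRep p`; (iii) no `p`-torsion in `E(ℚ_p)` (Mathlib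
`(W.baseChange ℚ_[p]).toAffine.Point`); (iv) `p ∤ tamagawaProduct W = ∏ c_ℓ`; the newform
`f ∈ S₂(Γ₀(N))` of `W` (`IsNewformOf W f`, any level — for a newform of `W` it is the conductor,
Carayol; the symbols depend on `f` only, and `𝒩₁` is read with `N_E = W.conductorNorm ℤ` as
printed); the period transfer `Ω(W) = u · Ω⁺_f`, `u ∈ ℚ`, `|u|_p = 1` (see below).
CONCLUSION: some `n ∈ 𝒩₁` (`Kato.IsKolyvaginProduct W p 1 n`: square-free, every `ℓ ∣ n` prime with
`ℓ ∤ N_E p`, `ℓ ≡ 1`, `a_ℓ ≡ ℓ + 1 (mod p)`; `n ≥ 1`) and surjective discrete logarithms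
`ψ_ℓ : (ℤ/ℓ)ˣ → ℤ/p` with `kuriharaNumber f p n ψ ≠ 0` (the clause "`ν(n) = ord(δ̃⁽¹⁾)`" is dropped:
weaker than print).
PERIODS (as in `KuriharaNumberKimCertificate`, point 1). Kim's `[r]⁺ = Re{∞,r}_f/Ω⁺_E` is normalised
by the Néron period `Ω⁺_E = W.realPeriodRat` of the globally minimal `W`; the tree's
`ratPlusSymbol f r = Re{∞,r}_f/Ω⁺_f` by `Ω⁺_f = plusPeriod f`. Under `Ω(W) = u·Ω⁺_f`, `|u|_p = 1`,
`ratPlusSymbol f r = u·[r]⁺` with both sides `p`-integral, so `kuriharaNumber f p n ψ = ū·δ̃⁽¹⁾_n` in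
`𝔽_p` with `ū ≠ 0` (`ratModP_eq_ratCast`), and "`δ̃⁽¹⁾_n ≠ 0`" is literally
"`kuriharaNumber f p n ψ ≠ 0`".
DISCRETE LOGARITHMS. Kim fixes primitive roots `η_ℓ`; `δ̃_n` is well defined up to a unit, so
non-vanishing for one surjective `ψ_ℓ : (ℤ/ℓ)ˣ → ℤ/p` (which exist as `p ∣ ℓ - 1`,
`exists_surjective_unitsHom`) is non-vanishing for all (`exists_units_kuriharaNumber_eq_mul`); the
statement asks for some.
With these readings the statement is WEAKER than the printed theorem, never stronger.

Not here: (1) ⇒ (3), statement (2), the rank formula (that is `Kim2022_kuriharaNumber_certificate`),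
the `p^k` versions (`KuriharaNumberKimNonvanishing` / `KuriharaNumberKimStructure`), the
supersingular / multiplicative cases; no `_holds` (size XL: the whole paper plus Kato 2004 and
Burungale–Castella–Skinner 2025, see the audit).

## References

* C.-H. Kim, arXiv:2203.12159 (Amer. J. Math.), Thm. 1.11, Cor. 1.5–1.6, §1.1.3, §1.2.2–1.2.4,
  §1.4, §6 [Kim2022StructureSelmer].
* K. Kato, Astérisque 295 (2004), Thm. 17.4 (3), §17.13 [Kato2004Asterisque].
* A. Burungale, F. Castella, C. Skinner, IMRN 2025 rnaf082 = arXiv:2405.00270v2, Thm. 1.1.2 and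
  Remark 1.1.3 (ii) [BurungaleCastellaSkinner2025].
* R. Greenberg, V. Vatsal, Invent. Math. 142 (2000), §3, Remark 3.4 [GreenbergVatsal2000];
  B. Mazur, Invent. Math. 44 (1978), Cor. 4.1 [Mazur1978]; A. Abbes, E. Ullmo, Compositio Math. 103
  (1996), Thm. A [AbbesUllmo1996].
-/

noncomputable section

open scoped MatrixGroups ModularForm Classical

open CongruenceSubgroup Literature.NumberTheory.EllipticCurves.ModularForms

namespace Literature.NumberTheory.EllipticCurves

/-- **Kim 2022, Thm. 1.11, (3) ⇒ (1) — in Kim's class at a good ordinary prime, some mod-`p`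
Kurihara number of an elliptic curve over `ℚ` is non-zero** (C.-H. Kim, arXiv:2203.12159 =
Amer. J. Math., Theorem 1.11: "Let `E` be an elliptic curve over `ℚ` and `p ≥ 5` a prime such
that (i) `ρ̄` is surjective, (ii) the Manin constant is prime to `p`, (iii) `E(ℚ_p)[p] = 0`, and
(iv) all the Tamagawa factors are prime to `p`. Then the following statements are equivalent.
(1) `δ̃⁽¹⁾_n ≠ 0` in `𝔽_p` for some `n ∈ 𝒩₁` with `ν(n) = ord(δ̃⁽¹⁾)`. … (3) (IMC) holds"; read here
as (3) ⇒ (1) WITHOUT the subsequent "if we further assume that `Ш(E/ℚ)[p]` is trivial" clause —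
no `Ш`, no rank — statement (3) being a THEOREM at a good ordinary `p ≥ 5` with `ρ̄` onto: Kato
2004 Thm. 17.4 (3) with Burungale–Castella–Skinner 2025 Thm. 1.1.2 (b), audited in
`KuriharaNumberKimCertificate` ("Status of statement (3)"); hypothesis (ii) automatic at a good
`p ≥ 5` by the paper's remark after Cor. 1.6 with Greenberg–Vatsal 2000 Rem. 3.4, see the module
docstring).
Let `W/ℚ` be globally minimal and elliptic, `p ≥ 5` a prime of good ORDINARY reduction
(`p ∤ a_p`) with `ρ̄_{E,p}` surjective, `E(ℚ_p)[p] = 0` and `p ∤ ∏_ℓ c_ℓ`; let `f ∈ S₂(Γ₀(N))` be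
the newform of `W` and assume the period transfer `Ω(W) = u · Ω⁺_f`, `u ∈ ℚ`, `|u|_p = 1` (it turns
Kim's Néron-normalised `δ̃⁽¹⁾_n` into `ū⁻¹ · kuriharaNumber f p n ψ`, `ū ∈ 𝔽_pˣ`; supplied under these
hypotheses by `realPeriodRat_eq_unit_mul_plusPeriod`). Then some square-free product `n ∈ 𝒩₁` of
Kolyvagin primes (`Kato.IsKolyvaginProduct W p 1 n`: every `ℓ ∣ n` prime with `ℓ ∤ N_E p`,
`ℓ ≡ 1`, `a_ℓ ≡ ℓ + 1 ≡ 2 (mod p)`) and some surjective discrete logarithms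
`ψ_ℓ : (ℤ/ℓ)ˣ → ℤ/p` have `kuriharaNumber f p n ψ ≠ 0` (the clause `ν(n) = ord(δ̃⁽¹⁾)` dropped:
weaker than print). Size XL; no `_holds`.
[cite: Kim2022StructureSelmer, Thm. 1.11 (3)⇒(1) (PDF p. 8) with Cor. 1.6 (p. 6), §1.2.2, §1.4.1–1.4.3; BurungaleCastellaSkinner2025, Thm. 1.1.2 (b) with Remark 1.1.3 (ii); Kato2004Asterisque, Thm. 17.4 (3) and §17.13; GreenbergVatsal2000, §3 Remark 3.4] -/
def Kim2022_exists_kuriharaNumber_modP_ne_zero : Prop :=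
  ∀ (W : WeierstrassCurve ℚ) [W.IsElliptic] [W.IsGloballyMinimal] (p : ℕ) [Fact p.Prime],
    5 ≤ p → W.HasGoodReductionAtPrime p → ¬ (p : ℤ) ∣ W.frobeniusTrace p →
    W.HasSurjectiveModNGaloisRep p →
    (∀ P : (W.baseChange ℚ_[p]).toAffine.Point, (p : ℤ) • P = 0 → P = 0) →
    ¬ p ∣ W.tamagawaProduct →
    ∀ {N : ℕ} [NeZero N] (f : CuspForm (Gamma0 N) 2), IsNewformOf W f →
    (∃ u : ℚ, ‖(u : ℚ_[p])‖ = 1 ∧ W.realPeriodRat = u * plusPeriod f) →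
    ∃ (n : ℕ) (_ : NeZero n), Kato.IsKolyvaginProduct W p 1 n ∧
      ∃ ψ : (ℓ : ℕ) → (ZMod ℓ)ˣ →* Multiplicative (ZMod p),
        (∀ ℓ ∈ n.primeFactors, Function.Surjective (ψ ℓ)) ∧ kuriharaNumber f p n ψ ≠ 0

end Literature.NumberTheory.EllipticCurves

end
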